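import Summits.KontsevichZagierPeriods.KontsevichZagierPeriods.Theorems.LinRedNormalFormArrangementNormalFormStubRebaseSimpleZeroNestedDiffRankOne
import Summits.KontsevichZagierPeriods.KontsevichZagierPeriods.Theorems.LinRedNormalFormArrangementNormalFormStubRebaseSimpleZeroNestedDiffCells

/-!
# Stub `stub_rebaseSimpleZeroTwo`, part `rebaseSimpleZero_nestedDifferent` (crux
`ArrangementNormalForm`, line `janus-bands`) — brick `NestedDiffFrameTools`

Dictionary for the frame change of variables of the edge expansion over a one-dimensional base
`y` with two fibres (literal class `GS 0 2`):
* `RebaseDiff.Kc`, `RebaseDiff.glitB_eq_Kc`, `RebaseDiff.fib_two`, `RebaseDiff.glitB_two` — the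
  literal integrand with two lettered fibres and a simple base pole is
  `K · (y − r)⁻¹ (tᵢ − cᵢ(y))⁻¹ (tⱼ − cⱼ(y))⁻¹` with the constant `K = p/∏ Lⱼ^{eⱼ}`;
* `RebaseDiff.cmpLin`, `RebaseDiff.cmpLin_iff` — a strict rational linear constraint
  `0 < η tᵢ + θ y + K` in one fibre and the base, encoded as a comparison between two PLAYERS
  (the fibre against an affine form of the base, or two affine forms), the input format of the
  total-order refinement `RebaseDiff.good_constraints`; `RebaseDiff.isSemialgebraic_cmpSet`;
* `RebaseDiff.sum_coord` — sums over the three coordinates `y, tᵢ, tⱼ`;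
* the BASE CHART of the frame piece (`RebaseDiff.coefA/xA/c₀A`, an instance of the rank-one
  map `RebaseDiff.rkMap`): `y = r + ((tᵢ − ρ) − b)/λ`, i.e. the new base coordinate is
  `b = (tᵢ − ρ) − λ (y − r) = tᵢ − cᵢ(y)` (`ρ = cᵢ(r)`), the fibres unchanged; its values
  (`RebaseDiff.yv_psiA`, `tv_psiA`, `yv_invA`, `tv_invA`), Jacobian `−1/λ` (`RebaseDiff.rkJac_A`),
  and the evaluation of affine forms of `y` in the chart (`RebaseDiff.ev_chartA`, registered as
  `rebaseSimpleZero_frameChartA`).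

References: M. Kontsevich, D. Zagier, *Periods* (2001), §1.2, rule (2).
-/

noncomputable section

open Set MeasureTheory MvPolynomial
open Literature.NumberTheory.Transcendental Literature.ModelTheory.ExponentialFields

namespace Summit.KontsevichZagierPeriods.ArrangementNormalForm.JanusBands

namespace RebaseDiff

open SeparatePos RebasePos RebaseZero RebaseNest

/-! ### The literal integrand with two lettered fibres -/

/-- The base constant `p/∏ Lⱼ^{eⱼ}` of the literal integrand over a one-dimensional base. -/
def Kc (T : BData) (p : MvPolynomial (Fin 0) ℚ) : ℝ :=
  ((p.coeff 0 : ℚ) : ℝ) / ∏ j', ((T.L j').2 : ℝ) ^ T.e j'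

/-- The literal integrand is `K · (y − ℓ₁)^{n₁}/(y − ℓ₂)^{n₂} · (letter block)`. -/
theorem glitB_eq_Kc (T : BData) (p : MvPolynomial (Fin 0) ℚ) (a : Fin 2 → Option Cf)
    (z : Fin (0 + 1 + 2) → ℝ) :
    glitB T p a z = Kc T p * ((yv z - T.ℓ₁.2) ^ T.n₁ / (yv z - T.ℓ₂.2) ^ T.n₂) * fib 0 2 a z := by
  have hp : MvPolynomial.aeval (fun i : Fin 0 => z (Fin.castAdd 2 (Fin.castSucc i))) p =
      ((p.coeff 0 : ℚ) : ℝ) := by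
    conv_lhs => rw [MvPolynomial.eq_C_of_isEmpty p]
    rw [MvPolynomial.aeval_C, eq_ratCast]
  rw [glitB, glit_eq, hp]
  simp only [affB_zero]
  rfl

/-- The letter block of two lettered fibres. -/
theorem fib_two {i j : Fin 2} (hij : i ≠ j) (a : Fin 2 → Option Cf) (ci cj : Cf) (hi : a i = some ci)
    (hj : a j = some cj) (z : Fin (0 + 1 + 2) → ℝ) :
    fib 0 2 a z = (1 / (tv z i - ev ci (yv z))) * (1 / (tv z j - ev cj (yv z))) := by
  rw [fib, prod_pair hij]
  simp only [hi, hj, Option.elim_some, sum_eq]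
  rfl

/-- **The literal integrand of a doubly lettered pair with a simple base pole** is
`K · (y − r)⁻¹ · (tᵢ − cᵢ(y))⁻¹ · (tⱼ − cⱼ(y))⁻¹`, `r = ℓ₂`. -/
theorem glitB_two (T : BData) (p : MvPolynomial (Fin 0) ℚ) (a : Fin 2 → Option Cf) {i j : Fin 2}
    (hij : i ≠ j) (ci cj : Cf) (hi : a i = some ci) (hj : a j = some cj) (h1 : T.n₁ = 0) (hn : T.n₂ = 1)
    (z : Fin (0 + 1 + 2) → ℝ) :
    glitB T p a z = Kc T p * (1 / (yv z - T.ℓ₂.2)) *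
      ((1 / (tv z i - ev ci (yv z))) * (1 / (tv z j - ev cj (yv z)))) := by
  rw [glitB_eq_Kc, fib_two hij a ci cj hi hj, h1, hn, pow_zero, pow_one, one_div]

/-! ### Linear constraints as player comparisons -/

/-- The strict constraint `0 < η tᵢ + θ y + K` as a comparison between two players. -/
def cmpLin (i : Fin 2) (η θ K : ℚ) : (Fin 2 ⊕ Cf) × (Fin 2 ⊕ Cf) :=
  if 0 < η then (Sum.inr (mk (-θ / η) (-K / η)), Sum.inl i)
  else if η < 0 then (Sum.inl i, Sum.inr (mk (-θ / η) (-K / η)))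
  else (Sum.inr (mk 0 0), Sum.inr (mk θ K))

/-- `cmpLin` encodes its constraint. -/
theorem cmpLin_iff (i : Fin 2) (η θ K : ℚ) (w : Fin (0 + 1 + 2) → ℝ) :
    pv (cmpLin i η θ K).1 w < pv (cmpLin i η θ K).2 w ↔ 0 < (η : ℝ) * tv w i + θ * yv w + K := by
  unfold cmpLin
  split_ifs with h1 h2
  · have hη : (0 : ℝ) < η := by exact_mod_cast h1
    rw [RebaseZero.pv_inr, RebaseZero.pv_inl, ev_mk]
    have : ((-θ / η : ℚ) : ℝ) * yv w + ((-K / η : ℚ) : ℝ) = -(θ * yv w + K) / η := by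
      push_cast; field_simp; ring
    rw [this, div_lt_iff₀ hη]
    constructor <;> intro h <;> linarith
  · have hη : (η : ℝ) < 0 := by exact_mod_cast h2
    rw [RebaseZero.pv_inr, RebaseZero.pv_inl, ev_mk]
    have : ((-θ / η : ℚ) : ℝ) * yv w + ((-K / η : ℚ) : ℝ) = -(θ * yv w + K) / η := by
      push_cast; field_simp; ring
    rw [this, lt_div_iff_of_neg hη]
    constructor <;> intro h <;> linarith
  · have hη : η = 0 := le_antisymm (not_lt.1 h1) (not_lt.1 h2)
    rw [RebaseZero.pv_inr, RebaseZero.pv_inr, ev_mk, ev_mk, hη]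
    push_cast
    constructor <;> intro h <;> linarith

/-- The first player of `cmpLin` is the fibre `i` or an affine form. -/
theorem cmpLin_fst_ne (i j : Fin 2) (hij : i ≠ j) (η θ K : ℚ) : (cmpLin i η θ K).1 ≠ Sum.inl j := by
  unfold cmpLin
  split_ifs <;> simp [hij]

/-- The second player of `cmpLin` is the fibre `i` or an affine form. -/
theorem cmpLin_snd_ne (i j : Fin 2) (hij : i ≠ j) (η θ K : ℚ) : (cmpLin i η θ K).2 ≠ Sum.inl j := by
  unfold cmpLin
  split_ifs <;> simp [hij]

/-- An order-constrained set is semialgebraic. -/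
theorem isSemialgebraic_cmpSet (C : Finset ((Fin 2 ⊕ Cf) × (Fin 2 ⊕ Cf))) :
    IsSemialgebraic ℚ {w : Fin (0 + 1 + 2) → ℝ | ∀ q ∈ C, pv q.1 w < pv q.2 w} := by
  -- adapted from `RebasePos.isSemialgebraic_orderSet` (…OneFibreSwap)
  have h : {w : Fin (0 + 1 + 2) → ℝ | ∀ q ∈ C, pv q.1 w < pv q.2 w} =
      ⋂ q ∈ C, {w | 0 < aeval w (playerPoly q.2 - playerPoly q.1)} := by
    ext w
    simp only [mem_setOf_eq, mem_iInter, map_sub, aeval_playerPoly, sub_pos, pv]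
  rw [h]
  exact IsSemialgebraic.biInter _ _ fun q _ => isSemialgebraic_setOf_eval_pos _

/-! ### Coordinates -/

/-- A sum over the two fibres, read on an ordered pair. -/
theorem sum_pair {M : Type*} [AddCommMonoid M] {i j : Fin 2} (hij : i ≠ j) (f : Fin 2 → M) :
    ∑ l, f l = f i + f j := by
  rw [Fin.sum_univ_two]
  fin_cases i <;> fin_cases j
  · exact absurd rfl hij
  · rfl
  · exact add_comm _ _
  · exact absurd rfl hij

/-- A sum over the three coordinates `y, tᵢ, tⱼ`. -/
theorem sum_coord {M : Type*} [AddCommMonoid M] {i j : Fin 2} (hij : i ≠ j) (g : Fin (0 + 1 + 2) → M) :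
    ∑ l, g l = g (yIdx 2) + (g (tIdx i) + g (tIdx j)) := by
  rw [Fin.sum_univ_add, ← sum_pair hij (fun l => g (tIdx l)), Fin.sum_univ_one]
  rfl

/-! ### The base chart of the frame piece -/

section ChartA

variable {i j : Fin 2} (hij : i ≠ j) (lam ρ r : ℚ)

/-- Coefficients of the rank-one functional of the base chart: `(1/λ) tᵢ − (1/λ + 1) y`. -/
def coefA (i : Fin 2) (lam : ℚ) : Fin (0 + 1 + 2) → ℚ :=
  Function.update (Function.update 0 (tIdx i) (1 / lam)) (yIdx 2) (-(1 / lam + 1))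

/-- The updated direction of the base chart: the base vector. -/
def xA : Fin (0 + 1 + 2) → ℚ := Pi.single (yIdx 2) 1

/-- The constant of the base chart. -/
def c₀A (lam ρ r : ℚ) : ℚ := r - ρ / lam

/-- The coefficient of `y`. -/
theorem coefA_y : coefA i lam (yIdx 2) = -(1 / lam + 1) := by
  simp [coefA]

/-- The coefficient of `tᵢ`. -/
theorem coefA_i : coefA i lam (tIdx i) = 1 / lam := by
  rw [coefA, Function.update_of_ne (yIdx_ne_tIdx i).symm, Function.update_self]

include hij in
/-- The coefficient of `tⱼ`. -/
theorem coefA_j : coefA i lam (tIdx j) = 0 := by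
  rw [coefA, Function.update_of_ne (yIdx_ne_tIdx j).symm,
    Function.update_of_ne (tIdx_injective.ne hij.symm)]
  rfl

include hij in
/-- The functional of the base chart. -/
theorem rkSumA (w : Fin (0 + 1 + 2) → ℝ) :
    ∑ l, (coefA i lam l : ℝ) * w l = (1 / lam) * tv w i - (1 / lam + 1) * yv w := by
  rw [sum_coord hij, coefA_y, coefA_i, coefA_j hij]
  simp only [tv, yv]
  push_cast
  ring

/-- The Jacobian number of the base chart is `−1/λ`. -/
theorem rkJac_A : rkJac (coefA i lam) xA = -(1 / lam) := by
  have h : ∑ l, coefA i lam l * xA l = coefA i lam (yIdx 2) := by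
    simp only [xA, Pi.single_apply, mul_ite, mul_one, mul_zero, Finset.sum_ite_eq', Finset.mem_univ,
      if_true]
  rw [rkJac, h, coefA_y]
  ring

/-- The Jacobian number of the base chart does not vanish. -/
theorem rkJac_A_ne (hlam : lam ≠ 0) : rkJac (coefA i lam) xA ≠ 0 := by
  rw [rkJac_A, neg_ne_zero]
  exact one_div_ne_zero hlam

include hij in
/-- **The base chart on the base coordinate**: `y = r + ((tᵢ − ρ) − b)/λ`. -/
theorem yv_psiA (w : Fin (0 + 1 + 2) → ℝ) :
    yv (rkMap (coefA i lam) xA (c₀A lam ρ r) w) = r + ((tv w i - ρ) - yv w) / lam := by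
  show rkMap (coefA i lam) xA (c₀A lam ρ r) w (yIdx 2) = _
  rw [rkMap_apply, rkSumA hij, c₀A]
  simp only [xA, Pi.single_eq_same, Rat.cast_one, mul_one, Rat.cast_sub, Rat.cast_div]
  show yv w + _ = _
  ring

/-- The base chart fixes the fibres. -/
theorem tv_psiA (w : Fin (0 + 1 + 2) → ℝ) (l : Fin 2) :
    tv (rkMap (coefA i lam) xA (c₀A lam ρ r) w) l = tv w l := by
  show rkMap (coefA i lam) xA (c₀A lam ρ r) w (tIdx l) = _
  rw [rkMap_apply]
  simp only [xA, Pi.single_eq_of_ne (yIdx_ne_tIdx l).symm, Rat.cast_zero, mul_zero, add_zero]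
  rfl

include hij in
/-- **The inverse base chart on the base coordinate**: `b = (tᵢ − ρ) − λ (y − r)`. -/
theorem yv_invA (hlam : lam ≠ 0) (z : Fin (0 + 1 + 2) → ℝ) :
    yv (rkInv (coefA i lam) xA (c₀A lam ρ r) z) = (tv z i - ρ) - lam * (yv z - r) := by
  have hl : (lam : ℝ) ≠ 0 := by exact_mod_cast hlam
  show rkInv (coefA i lam) xA (c₀A lam ρ r) z (yIdx 2) = _
  rw [rkInv_apply, rkSumA hij, rkJac_A, c₀A]
  simp only [xA, Pi.single_eq_same, Rat.cast_one, mul_one, Rat.cast_sub, Rat.cast_div, Rat.cast_neg]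
  show yv z - _ = _
  field_simp
  ring

/-- The inverse base chart fixes the fibres. -/
theorem tv_invA (z : Fin (0 + 1 + 2) → ℝ) (l : Fin 2) :
    tv (rkInv (coefA i lam) xA (c₀A lam ρ r) z) l = tv z l := by
  show rkInv (coefA i lam) xA (c₀A lam ρ r) z (tIdx l) = _
  rw [rkInv_apply]
  simp only [xA, Pi.single_eq_of_ne (yIdx_ne_tIdx l).symm, Rat.cast_zero, mul_zero, sub_zero]
  rfl

include hij in
/-- The inverse base chart followed by the base chart, on the base coordinate. -/
theorem chartA_roundtrip (hlam : lam ≠ 0) (z : Fin (0 + 1 + 2) → ℝ) :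
    (r : ℝ) + ((tv (rkInv (coefA i lam) xA (c₀A lam ρ r) z) i - ρ) -
      yv (rkInv (coefA i lam) xA (c₀A lam ρ r) z)) / lam = yv z := by
  have hl : (lam : ℝ) ≠ 0 := by exact_mod_cast hlam
  rw [tv_invA, yv_invA hij lam ρ r hlam]
  field_simp
  ring

/-- **Affine forms of `y` in the base chart**: `c(r + ((t − ρ) − b)/λ)` as a linear form in
`(t, b)`. -/
theorem ev_chartA (hlam : lam ≠ 0) (c : Cf) (b t : ℝ) :
    ev c (r + ((t - ρ) - b) / lam) = (c.1 (Fin.last 0) / lam : ℚ) * t +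
      (-(c.1 (Fin.last 0) / lam) : ℚ) * b + (c.1 (Fin.last 0) * r - c.1 (Fin.last 0) / lam * ρ + c.2 : ℚ) := by
  have hl : (lam : ℝ) ≠ 0 := by exact_mod_cast hlam
  simp only [ev, Rat.cast_div, Rat.cast_neg, Rat.cast_add, Rat.cast_sub, Rat.cast_mul]
  field_simp
  ring

end ChartA

end RebaseDiff

/-- Registered support goal of this file (brick of `rebaseSimpleZero_nestedDifferent`): in the
base chart `y = r + ((t − ρ) − b)/λ` of the frame piece of the edge expansion, an affine form
`c(y) = c₁ y + c₀` of the old base is the rational linear form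
`(c₁/λ) t − (c₁/λ) b + (c₁ r − c₁ ρ/λ + c₀)` of the fibre `t` and the new base `b`
(`RebaseDiff.ev_chartA`), so that the rows and the affine bounds of the old cell become
player comparisons in the new coordinates. -/
theorem rebaseSimpleZero_frameChartA (lam ρ r : ℚ) (hlam : lam ≠ 0) (c : (Fin (0 + 1) → ℚ) × ℚ) (b t : ℝ) : RebaseZero.ev c (r + ((t - ρ) - b) / lam) = (c.1 (Fin.last 0) / lam : ℚ) * t + (-(c.1 (Fin.last 0) / lam) : ℚ) * b + (c.1 (Fin.last 0) * r - c.1 (Fin.last 0) / lam * ρ + c.2 : ℚ) :=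
  RebaseDiff.ev_chartA lam ρ r hlam c b t

end Summit.KontsevichZagierPeriods.ArrangementNormalForm.JanusBands
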